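import Summits.ValiantsHypothesis.ValiantsHypothesis.Theorems.SymPencilPerFourInnerRankRows
import Summits.ValiantsHypothesis.ValiantsHypothesis.Theorems.SymPencilPerFourRowPairing
import Summits.ValiantsHypothesis.ValiantsHypothesis.Theorems.SymPencilPerFourPairingMinors

/-!
# Route `SymPencil` — two-row elements under the per-direction reading with `< 6` squares:
# the pairing matrix has corank `≥ 2`, hence STAR or BIPARTITE shape
# (`--supports` stmt-ValiantsHypothesis-5674 `SdcSuperquadratic`; a brick toward the residual
# `R6′` / `H106` of `Cruxes/SdcSuperquadratic/NEXT-RUNG-25.md` and `…/INNER-RANK-TEN.md`; rung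
# currency only)

Let `y` be a `4 × 4` matrix supported on the rows `0, 1`, `y₀ = α`, `y₁ = β`.  For every base
point `u`, `per_4 (u + s y)` has `s²`-coefficient `per (α; β; u₂; u₃) = u₂ᵀ P(α,β) u₃` with the
symmetric zero-diagonal PAIRING MATRIX `P(α,β)_{kl} = α_{k'} β_{l'} + α_{l'} β_{k'}`
(`{k',l'} = {k,l}ᶜ`; the matrix of `SymPencilPerFourRowPairing.det_pairing_eq`), a quadratic form
of rank `2 · rank P(α,β)` in the eight variables `u₂, u₃` (`per_rows_eq_pairing`,
`permanent_add_smul_rows01`).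

* `minors_of_sum_sq_swap_rows01`: if the per-direction ("swapped") reading at `y` has `< 6`
  squares — `per_4 (u + s y) = e₀ + e₁ s + s² Σ_{k ∈ ι} c_k Λ_k(u)²` for all `u`, `|ι| < 6` — then
  every `3 × 3` minor of `P(α,β)` vanishes (a non-zero minor gives a `6`-dimensional coordinate
  block on which the pairing is non-degenerate, while fewer than `6` squares have a common zero
  there).
* `SymPencilPerFourPairingMinors.star_or_bipartite`: for six scalars `a = m₀₁, b = m₀₂, c = m₀₃, d = m₁₂, e = m₁₃, f = m₂₃`
  (`m_{ij} = α_i β_j + α_j β_i`), the ten cubic relations expressing `rank P ≤ 2` force a STAR (some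
  index `i` with `m_{ij} = 0` for all `j`) or a BIPARTITE pattern (`m` vanishes on a perfect
  matching `{S, Sᶜ}` and is rank one across it, e.g. `m₀₁ = m₂₃ = 0`, `m₀₂ m₁₃ = m₀₃ m₁₂`).
* `star_or_bipartite_of_sum_sq_swap_rows01`: the two combined, for the rows `α, β` of `y`.

Use (successor of val-width-5674-p3's (10,6) lane): in a `6`-dimensional singular `V` without a
detecting pair of rows, every row pair `{r,s}` carries a non-zero two-row element of `V`; under
`H106`'s per-direction reading (`≤ 5` squares) each of them is star or bipartite — the sign-twisted
rows of val-width-5674-p1's exotic space `SymPencilPerFourSixDimExotic` are the star type with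
`β = λ (ε_i ∘ α)`.  Honest framing: a lemma; `sdc(per_4) ≥ 25` unchanged; the crux
`SdcSuperquadratic` and `VP ≠ VNP` untouched.  No definitions, no named facts. [folklore]
-/

noncomputable section

-- single-conjunct layout: Sub = Summit, duplicated namespace component intended
set_option linter.dupNamespace false

namespace Summit.ValiantsHypothesis.ValiantsHypothesis.Theorems.SymPencilPerFourTwoRowCorankTwo

open Matrix Finset Module MvPolynomial
open Literature.Computability.AlgebraicComplexity
open Summit.ValiantsHypothesis.ValiantsHypothesis.Theorems.SymPencilPerFourInnerRankRows
open Summit.ValiantsHypothesis.ValiantsHypothesis.Theorems.SymPencilPerFourPairingMinors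

variable {K : Type*} [Field K]

/-! ### The pairing matrix of two rows -/

/-- `per (α; β; v; w) = Σ_{k,l} v_k P(α,β)_{kl} w_l` with the pairing matrix of
`SymPencilPerFourRowPairing.det_pairing_eq`. [folklore] -/
theorem per_rows_eq_pairing (α β v w : Fin 4 → K) :
    (Matrix.of ![α, β, v, w]).permanent = ∑ k, ∑ l, v k *
      (Matrix.of ![![0, α 2 * β 3 + α 3 * β 2, α 1 * β 3 + α 3 * β 1, α 1 * β 2 + α 2 * β 1],
                   ![α 2 * β 3 + α 3 * β 2, 0, α 0 * β 3 + α 3 * β 0, α 0 * β 2 + α 2 * β 0],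
                   ![α 1 * β 3 + α 3 * β 1, α 0 * β 3 + α 3 * β 0, 0, α 0 * β 1 + α 1 * β 0],
                   ![α 1 * β 2 + α 2 * β 1, α 0 * β 2 + α 2 * β 0, α 0 * β 1 + α 1 * β 0, 0]] :
          Matrix (Fin 4) (Fin 4) K) k l * w l := by
  rw [permanent_of_rows]
  simp [Fin.sum_univ_four]
  ring

/-- **`per_4` along a two-row direction.**  For `y = (α; β; 0; 0)`:
`per_4 (u + s y) = per u + s (per (α; u₁; u₂; u₃) + per (u₀; β; u₂; u₃)) + s² per (α; β; u₂; u₃)`.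
[folklore] -/
theorem permanent_add_smul_rows01 (u₀ u₁ u₂ u₃ α β : Fin 4 → K) (s : K) :
    (Matrix.of ![u₀ + s • α, u₁ + s • β, u₂, u₃]).permanent =
      (Matrix.of ![u₀, u₁, u₂, u₃]).permanent +
        s * ((Matrix.of ![α, u₁, u₂, u₃]).permanent + (Matrix.of ![u₀, β, u₂, u₃]).permanent) +
        s ^ 2 * (Matrix.of ![α, β, u₂, u₃]).permanent := by
  simp only [permanent_of_rows, Pi.add_apply, Pi.smul_apply, smul_eq_mul]
  ring

/-- The matrix of `u + s (α; β; 0; 0)` by rows. [folklore] -/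
theorem of_add_smul_rows01 (u : Fin 4 × Fin 4 → K) (α β : Fin 4 → K) (s : K) :
    (Matrix.of fun i j => (u + s • (fun p : Fin 4 × Fin 4 =>
        if p.1 = 0 then α p.2 else if p.1 = 1 then β p.2 else 0)) (i, j)) =
      Matrix.of ![(fun j => u (0, j)) + s • α, (fun j => u (1, j)) + s • β,
        fun j => u (2, j), fun j => u (3, j)] := by
  ext i j
  fin_cases i <;> simp

/-- Sums against a vector extended by zero along an injection `I : Fin 3 → Fin 4`. [folklore] -/
theorem sum_extend_mul (I : Fin 3 → Fin 4) (v : Fin 3 → K)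
    (g : Fin 4 → K) :
    ∑ k : Fin 4, (∑ t : Fin 3, if k = I t then v t else 0) * g k = ∑ t, v t * g (I t) := by
  simp_rw [Finset.sum_mul, ite_mul, zero_mul]
  rw [Finset.sum_comm]
  refine Finset.sum_congr rfl fun t _ => ?_
  rw [Finset.sum_ite_eq' Finset.univ (I t)]
  simp

/-- The pairing of two zero-extended vectors is the pairing through the submatrix. [folklore] -/
theorem pairing_extend (P : Matrix (Fin 4) (Fin 4) K) (I J : Fin 3 → Fin 4) (v w : Fin 3 → K) :
    (∑ k : Fin 4, ∑ l : Fin 4, (∑ t : Fin 3, if k = I t then v t else 0) * P k l *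
        (∑ t' : Fin 3, if l = J t' then w t' else 0)) = v ⬝ᵥ ((P.submatrix I J) *ᵥ w) := by
  have h1 : ∀ k : Fin 4, (∑ l : Fin 4, (∑ t : Fin 3, if k = I t then v t else 0) * P k l *
      (∑ t' : Fin 3, if l = J t' then w t' else 0)) =
      (∑ t : Fin 3, if k = I t then v t else 0) * ∑ t' : Fin 3, w t' * P k (J t') := by
    intro k
    rw [← sum_extend_mul J w (fun l => P k l), Finset.mul_sum]
    exact Finset.sum_congr rfl fun l _ => by ring
  simp_rw [h1]
  rw [sum_extend_mul I v]
  simp only [dotProduct, Matrix.mulVec, Matrix.submatrix_apply]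
  exact Finset.sum_congr rfl fun t _ => by
    congr 1
    exact Finset.sum_congr rfl fun t' _ => mul_comm _ _

/-! ### Fewer than six squares: all `3 × 3` minors of the pairing matrix vanish -/

/-- **The per-direction reading with `< 6` squares at a two-row `y` kills every `3 × 3` minor of
the pairing matrix `P(α,β)`.**  See the module docstring. [folklore] -/
theorem minors_of_sum_sq_swap_rows01 [CharZero K] {ι : Type*} [Fintype ι]
    (hι : Fintype.card ι < 6) (α β : Fin 4 → K) (c : ι → K)
    (Λ : ι → ((Fin 4 × Fin 4 → K) →ₗ[K] K))
    (h : ∀ u : Fin 4 × Fin 4 → K, ∃ e₀ e₁ : K, ∀ s : K,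
      eval (u + s • (fun p : Fin 4 × Fin 4 => if p.1 = 0 then α p.2 else if p.1 = 1 then β p.2 else 0))
        (perPoly (Fin 4) K) = e₀ + s * e₁ + s ^ 2 * ∑ k, c k * (Λ k u) ^ 2)
    (I J : Fin 3 → Fin 4) :
    ((Matrix.of ![![0, α 2 * β 3 + α 3 * β 2, α 1 * β 3 + α 3 * β 1, α 1 * β 2 + α 2 * β 1],
                 ![α 2 * β 3 + α 3 * β 2, 0, α 0 * β 3 + α 3 * β 0, α 0 * β 2 + α 2 * β 0],
                 ![α 1 * β 3 + α 3 * β 1, α 0 * β 3 + α 3 * β 0, 0, α 0 * β 1 + α 1 * β 0],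
                 ![α 1 * β 2 + α 2 * β 1, α 0 * β 2 + α 2 * β 0, α 0 * β 1 + α 1 * β 0, 0]] :
        Matrix (Fin 4) (Fin 4) K).submatrix I J).det = 0 := by
  set P : Matrix (Fin 4) (Fin 4) K :=
    Matrix.of ![![0, α 2 * β 3 + α 3 * β 2, α 1 * β 3 + α 3 * β 1, α 1 * β 2 + α 2 * β 1],
               ![α 2 * β 3 + α 3 * β 2, 0, α 0 * β 3 + α 3 * β 0, α 0 * β 2 + α 2 * β 0],
               ![α 1 * β 3 + α 3 * β 1, α 0 * β 3 + α 3 * β 0, 0, α 0 * β 1 + α 1 * β 0],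
               ![α 1 * β 2 + α 2 * β 1, α 0 * β 2 + α 2 * β 0, α 0 * β 1 + α 1 * β 0, 0]] with hP
  by_contra hdet
  -- the per-base-point identity `Σ c_k Λ_k(u)² = per (α; β; u₂; u₃)`
  have hQ : ∀ u : Fin 4 × Fin 4 → K, ∑ k, c k * (Λ k u) ^ 2 =
      (Matrix.of ![α, β, fun j => u (2, j), fun j => u (3, j)]).permanent := by
    intro u
    obtain ⟨e₀, e₁, he⟩ := h u
    have hexp : ∀ s : K, e₀ + s * e₁ + s ^ 2 * ∑ k, c k * (Λ k u) ^ 2 =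
        (Matrix.of ![fun j => u (0, j), fun j => u (1, j), fun j => u (2, j), fun j => u (3, j)]).permanent +
        s * ((Matrix.of ![α, fun j => u (1, j), fun j => u (2, j), fun j => u (3, j)]).permanent +
          (Matrix.of ![fun j => u (0, j), β, fun j => u (2, j), fun j => u (3, j)]).permanent) +
        s ^ 2 * (Matrix.of ![α, β, fun j => u (2, j), fun j => u (3, j)]).permanent := fun s => by
      rw [← he s, eval_perPoly, of_add_smul_rows01, permanent_add_smul_rows01]
    have h0 := hexp 0
    have h1 := hexp 1
    have h1' := hexp (-1)
    have h2 : (2 : K) * ∑ k, c k * (Λ k u) ^ 2 =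
        2 * (Matrix.of ![α, β, fun j => u (2, j), fun j => u (3, j)]).permanent := by
      linear_combination h1 + h1' - 2 * h0
    exact (mul_right_inj' two_ne_zero).1 h2
  -- the `6`-dimensional coordinate block `rows 2 (columns I), 3 (columns J)`
  let emb : ((Fin 3 → K) × (Fin 3 → K)) →ₗ[K] (Fin 4 × Fin 4 → K) :=
    { toFun := fun vw p => if p.1 = 2 then ∑ t, (if p.2 = I t then vw.1 t else 0)
        else if p.1 = 3 then ∑ t, (if p.2 = J t then vw.2 t else 0) else 0
      map_add' := fun x y => by
        funext p
        simp only [Prod.fst_add, Prod.snd_add, Pi.add_apply]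
        split_ifs
        · rw [← Finset.sum_add_distrib]
          exact Finset.sum_congr rfl fun t _ => by split_ifs <;> simp
        · rw [← Finset.sum_add_distrib]
          exact Finset.sum_congr rfl fun t _ => by split_ifs <;> simp
        · simp
      map_smul' := fun r x => by
        funext p
        simp only [Prod.smul_fst, Prod.smul_snd, Pi.smul_apply, smul_eq_mul, RingHom.id_apply]
        split_ifs
        · rw [Finset.mul_sum]
          exact Finset.sum_congr rfl fun t _ => by split_ifs <;> simp
        · rw [Finset.mul_sum]
          exact Finset.sum_congr rfl fun t _ => by split_ifs <;> simp
        · simp }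
  have hemb2 : ∀ vw : (Fin 3 → K) × (Fin 3 → K), (fun j => emb vw (2, j)) =
      fun j => ∑ t, (if j = I t then vw.1 t else 0) := fun vw => by
    funext j; simp [emb]
  have hemb3 : ∀ vw : (Fin 3 → K) × (Fin 3 → K), (fun j => emb vw (3, j)) =
      fun j => ∑ t, (if j = J t then vw.2 t else 0) := fun vw => by
    funext j; simp [emb]
  -- pairing value on the block: `per (α; β; ext v; ext w) = v ⬝ (P_IJ w)`
  have hpair : ∀ v w : Fin 3 → K,
      (Matrix.of ![α, β, fun j => ∑ t, (if j = I t then v t else 0),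
        fun j => ∑ t, (if j = J t then w t else 0)]).permanent =
        v ⬝ᵥ ((P.submatrix I J) *ᵥ w) := by
    intro v w
    rw [per_rows_eq_pairing]
    exact pairing_extend P I J v w
  -- a common zero of the `Λ_k` in the block
  let L : ((Fin 3 → K) × (Fin 3 → K)) →ₗ[K] (ι → K) := LinearMap.pi fun k => (Λ k).comp emb
  have hker : LinearMap.ker L ≠ ⊥ :=
    LinearMap.ker_ne_bot_of_finrank_lt (by
      rw [finrank_prod, finrank_fintype_fun_eq_card, finrank_fintype_fun_eq_card,
        Fintype.card_fin]
      omega)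
  obtain ⟨x₀, hx₀, hx₀ne⟩ := Submodule.exists_mem_ne_zero_of_ne_bot hker
  have hΛ : ∀ k, Λ k (emb x₀) = 0 := fun k => by
    have := congr_fun (LinearMap.mem_ker.1 hx₀) k
    simpa [L] using this
  -- translation invariance of the form by `emb x₀`
  have hinv : ∀ x : (Fin 3 → K) × (Fin 3 → K),
      (x₀.1 + x.1) ⬝ᵥ ((P.submatrix I J) *ᵥ (x₀.2 + x.2)) = x.1 ⬝ᵥ ((P.submatrix I J) *ᵥ x.2) := by
    intro x
    have h1 := hQ (emb (x₀ + x))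
    have h2 := hQ (emb x)
    rw [hemb2, hemb3, hpair] at h1 h2
    rw [map_add] at h1
    simp_rw [LinearMap.map_add, hΛ, zero_add] at h1
    rw [Prod.fst_add, Prod.snd_add] at h1
    rw [← h1, ← h2]
  have h00 : x₀.1 ⬝ᵥ ((P.submatrix I J) *ᵥ x₀.2) = 0 := by
    have h' := hinv (0, 0)
    simpa using h'
  have hv : x₀.1 = 0 := by
    apply Matrix.eq_zero_of_vecMul_eq_zero hdet
    funext t
    have h := hinv (0, Pi.single t 1)
    simp only [add_zero, zero_dotProduct] at h
    rw [Matrix.mulVec_add, dotProduct_add, h00, zero_add, Matrix.dotProduct_mulVec,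
      dotProduct_single, mul_one] at h
    rw [h, Pi.zero_apply]
  have hw : x₀.2 = 0 := by
    apply Matrix.eq_zero_of_mulVec_eq_zero hdet
    funext t
    have h := hinv (Pi.single t 1, 0)
    simp only [add_zero, dotProduct_zero, Matrix.mulVec_zero] at h
    rw [add_dotProduct, h00, zero_add, single_dotProduct, one_mul] at h
    rw [h, Pi.zero_apply]
  exact hx₀ne (Prod.ext hv hw)

/-! ### Star or bipartite -/

/-- **Two-row elements under the per-direction reading with `< 6` squares are STAR or
BIPARTITE.**  For `y = (α; β; 0; 0)` with `per_4 (u + s y) = e₀ + e₁ s + s² Σ_{k∈ι} c_k Λ_k(u)²`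
(`|ι| < 6`) and `m_{ij} = α_i β_j + α_j β_i`: some index `i` has `m_{ij} = 0` for all `j ≠ i`, or
`m` vanishes on a perfect matching and is rank one across it. [folklore] -/
theorem star_or_bipartite_of_sum_sq_swap_rows01 [CharZero K] {ι : Type*} [Fintype ι]
    (hι : Fintype.card ι < 6) (α β : Fin 4 → K) (c : ι → K)
    (Λ : ι → ((Fin 4 × Fin 4 → K) →ₗ[K] K))
    (h : ∀ u : Fin 4 × Fin 4 → K, ∃ e₀ e₁ : K, ∀ s : K,
      eval (u + s • (fun p : Fin 4 × Fin 4 => if p.1 = 0 then α p.2 else if p.1 = 1 then β p.2 else 0))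
        (perPoly (Fin 4) K) = e₀ + s * e₁ + s ^ 2 * ∑ k, c k * (Λ k u) ^ 2) :
    ((α 0 * β 1 + α 1 * β 0 = 0 ∧ α 0 * β 2 + α 2 * β 0 = 0 ∧ α 0 * β 3 + α 3 * β 0 = 0) ∨
      (α 0 * β 1 + α 1 * β 0 = 0 ∧ α 1 * β 2 + α 2 * β 1 = 0 ∧ α 1 * β 3 + α 3 * β 1 = 0) ∨
      (α 0 * β 2 + α 2 * β 0 = 0 ∧ α 1 * β 2 + α 2 * β 1 = 0 ∧ α 2 * β 3 + α 3 * β 2 = 0) ∨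
      (α 0 * β 3 + α 3 * β 0 = 0 ∧ α 1 * β 3 + α 3 * β 1 = 0 ∧ α 2 * β 3 + α 3 * β 2 = 0)) ∨
    ((α 0 * β 1 + α 1 * β 0 = 0 ∧ α 2 * β 3 + α 3 * β 2 = 0 ∧
        (α 0 * β 2 + α 2 * β 0) * (α 1 * β 3 + α 3 * β 1) =
          (α 0 * β 3 + α 3 * β 0) * (α 1 * β 2 + α 2 * β 1)) ∨
      (α 0 * β 2 + α 2 * β 0 = 0 ∧ α 1 * β 3 + α 3 * β 1 = 0 ∧
        (α 0 * β 1 + α 1 * β 0) * (α 2 * β 3 + α 3 * β 2) =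
          (α 0 * β 3 + α 3 * β 0) * (α 1 * β 2 + α 2 * β 1)) ∨
      (α 0 * β 3 + α 3 * β 0 = 0 ∧ α 1 * β 2 + α 2 * β 1 = 0 ∧
        (α 0 * β 1 + α 1 * β 0) * (α 2 * β 3 + α 3 * β 2) =
          (α 0 * β 2 + α 2 * β 0) * (α 1 * β 3 + α 3 * β 1))) := by
  have hm := minors_of_sum_sq_swap_rows01 hι α β c Λ h
  set a := α 0 * β 1 + α 1 * β 0
  set b := α 0 * β 2 + α 2 * β 0
  set c' := α 0 * β 3 + α 3 * β 0
  set d := α 1 * β 2 + α 2 * β 1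
  set e := α 1 * β 3 + α 3 * β 1
  set f := α 2 * β 3 + α 3 * β 2
  have key := star_or_bipartite (a := a) (b := b) (c := c') (d := d) (e := e) (f := f)
    (by rw [← minor_123_123 a b c' d e f]; exact hm _ _)
    (by rw [← minor_023_023 a b c' d e f]; exact hm _ _)
    (by rw [← minor_013_013 a b c' d e f]; exact hm _ _)
    (by rw [← minor_012_012 a b c' d e f]; exact hm _ _)
    (by rw [← minor_023_123 a b c' d e f]; exact hm _ _)
    (by rw [← minor_012_013 a b c' d e f]; exact hm _ _)
    (by rw [← minor_013_123 a b c' d e f]; exact hm _ _)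
    (by rw [← minor_012_023 a b c' d e f]; exact hm _ _)
    (by rw [← minor_012_123 a b c' d e f]; exact hm _ _)
    (by rw [← minor_013_023 a b c' d e f]; exact hm _ _)
  rcases key with h | h | h | h | h | h | h
  · exact Or.inl (Or.inl h)
  · exact Or.inl (Or.inr (Or.inl h))
  · exact Or.inl (Or.inr (Or.inr (Or.inl h)))
  · exact Or.inl (Or.inr (Or.inr (Or.inr h)))
  · exact Or.inr (Or.inl h)
  · exact Or.inr (Or.inr (Or.inl h))
  · exact Or.inr (Or.inr (Or.inr h))

/-! ### Any row pair, and the column version (transport) -/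

open Summit.ValiantsHypothesis.ValiantsHypothesis.Theorems.SymPencilPerFourBlocks
open Summit.ValiantsHypothesis.ValiantsHypothesis.Theorems.SymPencilPerFourTwoRowsRadical

/-- **Transport of a per-direction family at one direction** along a `per_4`-preserving linear
automorphism `Φ`: the family at `y` gives the family at `Φ y` with `Λ_k ∘ Φ⁻¹`. [folklore] -/
theorem sum_sq_swap_map {ι : Type*} [Fintype ι] (Φ : (Fin 4 × Fin 4 → K) ≃ₗ[K] (Fin 4 × Fin 4 → K))
    (hΦ : ∀ z, eval (Φ z) (perPoly (Fin 4) K) = eval z (perPoly (Fin 4) K))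
    (y : Fin 4 × Fin 4 → K) (c : ι → K) (Λ : ι → ((Fin 4 × Fin 4 → K) →ₗ[K] K))
    (h : ∀ u : Fin 4 × Fin 4 → K, ∃ e₀ e₁ : K, ∀ s : K,
      eval (u + s • y) (perPoly (Fin 4) K) = e₀ + s * e₁ + s ^ 2 * ∑ k, c k * (Λ k u) ^ 2) :
    ∀ u : Fin 4 × Fin 4 → K, ∃ e₀ e₁ : K, ∀ s : K,
      eval (u + s • Φ y) (perPoly (Fin 4) K) =
        e₀ + s * e₁ + s ^ 2 * ∑ k, c k * ((Λ k).comp Φ.symm.toLinearMap u) ^ 2 := by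
  intro u
  obtain ⟨e₀, e₁, he⟩ := h (Φ.symm u)
  refine ⟨e₀, e₁, fun s => ?_⟩
  have hu : u + s • Φ y = Φ (Φ.symm u + s • y) := by
    rw [map_add, map_smul, LinearEquiv.apply_symm_apply]
  rw [hu, hΦ, he s]
  rfl

/-- **Two-row elements on any pair of rows `p ≠ q` are STAR or BIPARTITE** under the
per-direction reading with `< 6` squares: for `y` supported on the rows `p, q` with
`α = y_p`, `β = y_q`, the conclusion of `star_or_bipartite_of_sum_sq_swap_rows01` holds.
[folklore] -/
theorem star_or_bipartite_of_sum_sq_swap_rows [CharZero K] {ι : Type*} [Fintype ι]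
    (hι : Fintype.card ι < 6) {p q : Fin 4} (hpq : p ≠ q) (y : Fin 4 × Fin 4 → K)
    (hy : ∀ i j : Fin 4, i ≠ p → i ≠ q → y (i, j) = 0) (c : ι → K)
    (Λ : ι → ((Fin 4 × Fin 4 → K) →ₗ[K] K))
    (h : ∀ u : Fin 4 × Fin 4 → K, ∃ e₀ e₁ : K, ∀ s : K,
      eval (u + s • y) (perPoly (Fin 4) K) = e₀ + s * e₁ + s ^ 2 * ∑ k, c k * (Λ k u) ^ 2) :
    let α : Fin 4 → K := fun j => y (p, j)
    let β : Fin 4 → K := fun j => y (q, j)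
    ((α 0 * β 1 + α 1 * β 0 = 0 ∧ α 0 * β 2 + α 2 * β 0 = 0 ∧ α 0 * β 3 + α 3 * β 0 = 0) ∨
      (α 0 * β 1 + α 1 * β 0 = 0 ∧ α 1 * β 2 + α 2 * β 1 = 0 ∧ α 1 * β 3 + α 3 * β 1 = 0) ∨
      (α 0 * β 2 + α 2 * β 0 = 0 ∧ α 1 * β 2 + α 2 * β 1 = 0 ∧ α 2 * β 3 + α 3 * β 2 = 0) ∨
      (α 0 * β 3 + α 3 * β 0 = 0 ∧ α 1 * β 3 + α 3 * β 1 = 0 ∧ α 2 * β 3 + α 3 * β 2 = 0)) ∨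
    ((α 0 * β 1 + α 1 * β 0 = 0 ∧ α 2 * β 3 + α 3 * β 2 = 0 ∧
        (α 0 * β 2 + α 2 * β 0) * (α 1 * β 3 + α 3 * β 1) =
          (α 0 * β 3 + α 3 * β 0) * (α 1 * β 2 + α 2 * β 1)) ∨
      (α 0 * β 2 + α 2 * β 0 = 0 ∧ α 1 * β 3 + α 3 * β 1 = 0 ∧
        (α 0 * β 1 + α 1 * β 0) * (α 2 * β 3 + α 3 * β 2) =
          (α 0 * β 3 + α 3 * β 0) * (α 1 * β 2 + α 2 * β 1)) ∨
      (α 0 * β 3 + α 3 * β 0 = 0 ∧ α 1 * β 2 + α 2 * β 1 = 0 ∧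
        (α 0 * β 1 + α 1 * β 0) * (α 2 * β 3 + α 3 * β 2) =
          (α 0 * β 2 + α 2 * β 0) * (α 1 * β 3 + α 3 * β 1))) := by
  intro α β
  obtain ⟨σ, hσ0, hσ1⟩ := exists_perm_zero_one p q hpq
  set e := Equiv.prodCongr σ (1 : Equiv.Perm (Fin 4)) with he
  set Φ : (Fin 4 × Fin 4 → K) ≃ₗ[K] (Fin 4 × Fin 4 → K) := LinearEquiv.funCongrLeft K K e with hΦ
  have hΦa : ∀ (x : Fin 4 × Fin 4 → K) (i j : Fin 4), Φ x (i, j) = x (σ i, j) := fun x i j => by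
    simp [hΦ, he]
  have hΦper : ∀ z, eval (Φ z) (perPoly (Fin 4) K) = eval z (perPoly (Fin 4) K) := fun z => by
    have : (Φ z : Fin 4 × Fin 4 → K) = z ∘ e := rfl
    rw [this, he, eval_perPoly_comp_prodCongr]
  have h2 : σ 2 ≠ p ∧ σ 2 ≠ q := by
    constructor
    · rw [← hσ0]; exact fun h => by have := σ.injective h; exact absurd this (by decide)
    · rw [← hσ1]; exact fun h => by have := σ.injective h; exact absurd this (by decide)
  have h3 : σ 3 ≠ p ∧ σ 3 ≠ q := by
    constructor
    · rw [← hσ0]; exact fun h => by have := σ.injective h; exact absurd this (by decide)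
    · rw [← hσ1]; exact fun h => by have := σ.injective h; exact absurd this (by decide)
  have hy' : Φ y = fun r : Fin 4 × Fin 4 =>
      if r.1 = 0 then α r.2 else if r.1 = 1 then β r.2 else 0 := by
    funext ⟨i, j⟩
    rw [hΦa]
    fin_cases i
    · simp [hσ0, α]
    · simp [hσ1, β]
    · simp [hy (σ 2) j h2.1 h2.2]
    · simp [hy (σ 3) j h3.1 h3.2]
  have h' := sum_sq_swap_map Φ hΦper y c Λ h
  rw [hy'] at h'
  exact star_or_bipartite_of_sum_sq_swap_rows01 hι α β c _ h'

/-- **Two-column elements are STAR or BIPARTITE** (transpose of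
`star_or_bipartite_of_sum_sq_swap_rows`): for `y` supported on the columns `p ≠ q` with
`α = y_{·p}`, `β = y_{·q}`. [folklore] -/
theorem star_or_bipartite_of_sum_sq_swap_cols [CharZero K] {ι : Type*} [Fintype ι]
    (hι : Fintype.card ι < 6) {p q : Fin 4} (hpq : p ≠ q) (y : Fin 4 × Fin 4 → K)
    (hy : ∀ i j : Fin 4, j ≠ p → j ≠ q → y (i, j) = 0) (c : ι → K)
    (Λ : ι → ((Fin 4 × Fin 4 → K) →ₗ[K] K))
    (h : ∀ u : Fin 4 × Fin 4 → K, ∃ e₀ e₁ : K, ∀ s : K,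
      eval (u + s • y) (perPoly (Fin 4) K) = e₀ + s * e₁ + s ^ 2 * ∑ k, c k * (Λ k u) ^ 2) :
    let α : Fin 4 → K := fun i => y (i, p)
    let β : Fin 4 → K := fun i => y (i, q)
    ((α 0 * β 1 + α 1 * β 0 = 0 ∧ α 0 * β 2 + α 2 * β 0 = 0 ∧ α 0 * β 3 + α 3 * β 0 = 0) ∨
      (α 0 * β 1 + α 1 * β 0 = 0 ∧ α 1 * β 2 + α 2 * β 1 = 0 ∧ α 1 * β 3 + α 3 * β 1 = 0) ∨
      (α 0 * β 2 + α 2 * β 0 = 0 ∧ α 1 * β 2 + α 2 * β 1 = 0 ∧ α 2 * β 3 + α 3 * β 2 = 0) ∨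
      (α 0 * β 3 + α 3 * β 0 = 0 ∧ α 1 * β 3 + α 3 * β 1 = 0 ∧ α 2 * β 3 + α 3 * β 2 = 0)) ∨
    ((α 0 * β 1 + α 1 * β 0 = 0 ∧ α 2 * β 3 + α 3 * β 2 = 0 ∧
        (α 0 * β 2 + α 2 * β 0) * (α 1 * β 3 + α 3 * β 1) =
          (α 0 * β 3 + α 3 * β 0) * (α 1 * β 2 + α 2 * β 1)) ∨
      (α 0 * β 2 + α 2 * β 0 = 0 ∧ α 1 * β 3 + α 3 * β 1 = 0 ∧
        (α 0 * β 1 + α 1 * β 0) * (α 2 * β 3 + α 3 * β 2) =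
          (α 0 * β 3 + α 3 * β 0) * (α 1 * β 2 + α 2 * β 1)) ∨
      (α 0 * β 3 + α 3 * β 0 = 0 ∧ α 1 * β 2 + α 2 * β 1 = 0 ∧
        (α 0 * β 1 + α 1 * β 0) * (α 2 * β 3 + α 3 * β 2) =
          (α 0 * β 2 + α 2 * β 0) * (α 1 * β 3 + α 3 * β 1))) := by
  intro α β
  set Φ : (Fin 4 × Fin 4 → K) ≃ₗ[K] (Fin 4 × Fin 4 → K) :=
    LinearEquiv.funCongrLeft K K (Equiv.prodComm (Fin 4) (Fin 4)) with hΦ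
  have hΦa : ∀ (x : Fin 4 × Fin 4 → K) (i j : Fin 4), Φ x (i, j) = x (j, i) := fun x i j => rfl
  have h' := sum_sq_swap_map Φ eval_perPoly_transpose y c Λ h
  have hyT : ∀ i j : Fin 4, i ≠ p → i ≠ q → Φ y (i, j) = 0 := fun i j hi hj => by
    rw [hΦa]; exact hy j i hi hj
  exact star_or_bipartite_of_sum_sq_swap_rows hι hpq (Φ y) hyT c _ h'

end Summit.ValiantsHypothesis.ValiantsHypothesis.Theorems.SymPencilPerFourTwoRowCorankTwo

end
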